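import Summits.MatrixMultiplication.MatrixMultiplication.Theorems.FarEdgeDescentCornerZeroSet
import Summits.MatrixMultiplication.MatrixMultiplication.Theorems.SaturationLadderExpSaturation

/-!
# Route `FarEdgeDescent` — the ray dichotomy at the far corner, HYPOTHESIS-FREE by name

decomp-mm ROOT cell (D-0178), lens 2 «structural dichotomy: special vs generic», gen 14 (critic's suggestion on
N2¹³, CLEARED 2026-08-30T12:49Z).

`Theorems/FarEdgeDescentCornerZeroSet.lean` (gen 13) proves the ray dichotomy of the saturated zone
`Z = {(a,c) ∈ [0,1]² : ω(a,1,c) = 1 + max a c}` at the far corner `(0,0)`: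
* GENERIC half `corner_dichotomy_generic` — every ray of slope `t ∈ [0,1)` (and its mirror) has an initial segment
  in `Z`, stated there UNDER the hypothesis `hET : ∀ t ∈ [0,1), ∃ r ≥ 1, ω(1,t,r) ≤ 1 + r`;
* SPECIAL half `corner_dichotomy_special` — the diagonal ray has an initial segment in `Z` iff `FiniteSaturation`.

The hypothesis `hET` is LITERALLY lens 1's item `SaturationLadder.EventualTightness` (stmt-MatrixMultiplication-24102),
CLOSED·PROVED in the tree by `SaturationLadderExpSaturation.eventualTightness_holds`.  This module composes the two
landed theorems so that the dichotomy reads without hypotheses: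

* `generic_rays_settled` : the generic half, unconditionally;
* `ray_dichotomy`        : (generic half) ∧ (special half ↔ `FiniteSaturation`);
* `finiteSaturation_iff_all_rays` : the special leaf ⟺ EVERY ray of slope `t ∈ [0,1]` through the corner has an
  initial saturated segment — i.e. `FiniteSaturation` is exactly the statement that `Z` is a neighbourhood of the
  corner inside the square (the generic class being settled, only the kink direction `t = 1` is open).

Support module for item 23739 (`FiniteSaturation`); no new definitions; imports only tree modules.  Nothing here
proves `ω = 2`.
-/

set_option linter.dupNamespace false

noncomputable section

namespace Summit.MatrixMultiplication.MatrixMultiplication.Theorems.FarEdgeDescentCornerDichotomy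

open Literature.Computability.AlgebraicComplexity
open Summit.MatrixMultiplication.MatrixMultiplication.Theorems.FarEdgeDescentCornerZeroSet
open Summit.MatrixMultiplication.MatrixMultiplication.Theorems.SaturationLadderExpSaturation
  (eventualTightness_holds)
open Summit.MatrixMultiplication.MatrixMultiplication.Theses.FarEdgeDescent (FiniteSaturation)

/-- **Generic rays are settled** (hypothesis-free): for every slope `t ∈ [0,1)` the two mirror rays
`μ ↦ (μ, tμ)` and `μ ↦ (tμ, μ)` through the far corner have an initial segment inside the saturated zone `Z` —
`corner_dichotomy_generic` fed with lens 1's landed `eventualTightness_holds` (item 24102). -/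
theorem generic_rays_settled {t : ℝ} (ht0 : 0 ≤ t) (ht1 : t < 1) :
    ∃ a : ℝ, 0 < a ∧ ∀ μ : ℝ, 0 ≤ μ → μ ≤ a →
      omegaRect ℂ μ 1 (t * μ) = 1 + max μ (t * μ) ∧ omegaRect ℂ (t * μ) 1 μ = 1 + max (t * μ) μ :=
  corner_dichotomy_generic eventualTightness_holds ht0 ht1

/-- **The ray dichotomy, hypothesis-free**: (every non-diagonal ray is saturated near the corner) ∧
(the diagonal ray is saturated near the corner ↔ `FiniteSaturation`). -/
theorem ray_dichotomy :
    (∀ t : ℝ, 0 ≤ t → t < 1 → ∃ a : ℝ, 0 < a ∧ ∀ μ : ℝ, 0 ≤ μ → μ ≤ a →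
        omegaRect ℂ μ 1 (t * μ) = 1 + max μ (t * μ) ∧ omegaRect ℂ (t * μ) 1 μ = 1 + max (t * μ) μ) ∧
      ((∃ a : ℝ, 0 < a ∧ a ≤ 1 / 2 ∧ ∀ μ : ℝ, 0 ≤ μ → μ ≤ a → omegaRect ℂ μ 1 μ = 1 + max μ μ) ↔
        FiniteSaturation) :=
  ⟨fun _ ht0 ht1 => generic_rays_settled ht0 ht1, corner_dichotomy_special⟩

/-- **The special leaf as a neighbourhood statement**: `FiniteSaturation` ⟺ EVERY ray of slope `t ∈ [0,1]`
through the far corner has an initial saturated segment (slopes `t < 1` are theorems; only the kink direction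
`t = 1` is open — the exhaustive special/generic split of the corner germ of `Z`). -/
theorem finiteSaturation_iff_all_rays :
    FiniteSaturation ↔ ∀ t : ℝ, 0 ≤ t → t ≤ 1 → ∃ a : ℝ, 0 < a ∧ ∀ μ : ℝ, 0 ≤ μ → μ ≤ a →
      omegaRect ℂ μ 1 (t * μ) = 1 + max μ (t * μ) := by
  constructor
  · intro hFS t ht0 ht1
    rcases lt_or_eq_of_le ht1 with hlt | rfl
    · obtain ⟨a, ha0, ha⟩ := generic_rays_settled ht0 hlt
      exact ⟨a, ha0, fun μ hμ0 hμa => (ha μ hμ0 hμa).1⟩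
    · obtain ⟨a, ha0, -, ha⟩ := corner_dichotomy_special.2 hFS
      refine ⟨a, ha0, fun μ hμ0 hμa => ?_⟩
      rw [one_mul]
      exact ha μ hμ0 hμa
  · intro h
    obtain ⟨a, ha0, ha⟩ := h 1 zero_le_one le_rfl
    refine corner_dichotomy_special.1 ⟨min a (1 / 2), lt_min ha0 (by norm_num), min_le_right _ _,
      fun μ hμ0 hμa => ?_⟩
    have := ha μ hμ0 (hμa.trans (min_le_left _ _))
    rwa [one_mul] at this

/-- The round world restated on rays: if `FiniteSaturation` fails, the saturated zone `Z` contains an initial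
segment of EVERY ray of slope `t < 1` and of NO point of the diagonal beyond the corner — `Z` reaches the corner
tangentially to the diagonal from both sides ("kissing lenses"). -/
theorem round_world_rays (h : ¬ FiniteSaturation) :
    (∀ t : ℝ, 0 ≤ t → t < 1 → ∃ a : ℝ, 0 < a ∧ ∀ μ : ℝ, 0 ≤ μ → μ ≤ a →
        omegaRect ℂ μ 1 (t * μ) = 1 + max μ (t * μ)) ∧
      ∀ s : ℝ, 0 < s → 1 + s < omegaRect ℂ s 1 s :=
  ⟨fun _ ht0 ht1 => by
      obtain ⟨a, ha0, ha⟩ := generic_rays_settled ht0 ht1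
      exact ⟨a, ha0, fun μ hμ0 hμa => (ha μ hμ0 hμa).1⟩,
    fun _ hs => round_world h hs⟩

end Summit.MatrixMultiplication.MatrixMultiplication.Theorems.FarEdgeDescentCornerDichotomy

end
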